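import Literature.NumberTheory.PAdicHodge.BdRPlusLogTeichGalois
import Literature.NumberTheory.PAdicHodge.TatePairingCochainLegendre
import HarnessLib

/-!
# (K₂) on a spanning family implies (K₂) on the resolution cochain: `p^N x̃(η σ) ∈ X⁰₂`, `p`-adically small near `1`

Topic `Literature/NumberTheory/PAdicHodge`; THEOREMS ONLY (no definition, no named fact, no instance, no `sorry`). Bookkeeping for the
hypothesis (K₂) of `RecognitionFromTeichLog.exists_recognition_of_isTeichLog` / `TatePairingPointOfTeichLogRecognition`: the `X₂`-membership
of the Legendre resolution `x̃(a) = Pη(a) b_ω − Pω(a) b_η` (`TatePairingCochainLegendre`) needs to be checked on finitely many elements only.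

★ `isTeichLog_resolution_of_coordinates` / ★★ `eventually_resolution_small_of_coordinates` — if `Pω, Pη` are `ℤ_p`-homogeneous, the cocycle
`η` has continuous `ℤ_p`-coordinates `η(σ) = Σᵢ cᵢ(σ) · vᵢ` with `cᵢ(1) = 0` on a finite family `(vᵢ)`, and **`p^N x̃(vᵢ) ∈ X⁰₂` for each `i`**,
then `p^N x̃(η σ) ∈ X⁰₂` for every `σ` (`X⁰₂` is a `ℤ_p`-module, `BdRPlusLogTeich`) and, for every `M`, `p^N x̃(η σ) = p^M · L'_σ` with
`L'_σ ∈ X⁰₂` for all `σ` near `1` (the coordinates are `p^M`-divisible near `1`, `BdRPlusLogTeichGalois` §3) — verbatim the hypotheses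
`hX`, `hXsmall` of the recognition theorem. So Kato's explicit reciprocity law at a completion is reduced to the membership of the TWO
elements `p^N x̃(v₀), p^N x̃(v₁)` (`(v₀, v₁)` a `ℤ_p`-basis of `T_pW`) in `X⁰₂ + Fil²`.

Line `kato_lever` of crux K★ `stmt-BirchSwinnertonDyer-22226`; BSD / K★ / [REC] are NOT proved by any of this.

## References
* K. Kato, LNM 1553 (1993), Ch. II §1.2.4–1.2.5, proof of Lemma 1.4.3. [Kato1993LNM1553]
* J.-M. Fontaine, Y. Ouyang, *Theory of p-adic Galois representations*, §6.1 (`(B_crys⁺)^{φ=p}` is a `ℚ_p`-space). [FontaineOuyang2022]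
-/

noncomputable section

open Field Function ValuativeRel WittVector
open scoped Topology

namespace Literature.NumberTheory.PAdicHodge

open Literature.NumberTheory.GaloisRepresentations
open Literature.NumberTheory.GaloisRepresentations.IsNonarchimedeanLocalField
open Literature.NumberTheory.GaloisCohomology
open Literature.NumberTheory.EllipticCurves
open Literature.NumberTheory.PAdicHodge.GaloisContinuity
open _root_.WeierstrassCurve

namespace BdRPlusTop

variable {F : Type} [Field F] [ValuativeRel F] [TopologicalSpace F] [IsNonarchimedeanLocalField F] [CharZero F]
  {p : ℕ} [Fact p.Prime] [Fact (¬ IsUnit (p : integerC F))] [IsAdicComplete (Ideal.span {(p : integerC F)}) (integerC F)]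
  {K₀ : Type} [Field K₀] (W : WeierstrassCurve K₀)
  {Pω Pη : W.tateModule p →+ BdRPlusTop F p}
  (hPωZ : ∀ (c : ℤ_[p]) (a : W.tateModule p), Pω (c • a) = of F p (qpToBdR (c : ℚ_[p])) * Pω a)
  (hPηZ : ∀ (c : ℤ_[p]) (a : W.tateModule p), Pη (c • a) = of F p (qpToBdR (c : ℚ_[p])) * Pη a)

omit [CharZero F] in
include hPωZ hPηZ in
/-- **`ℤ_p`-homogeneity of the resolution**: `x̃(c • a) = c · x̃(a)`. [cite: Kato1993LNM1553, Ch. II §1.2.4] -/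
theorem resolution_padicInt_smul (bω bη : BdRPlusTop F p) (c : ℤ_[p]) (a : W.tateModule p) :
    Pη (c • a) * bω - Pω (c • a) * bη = of F p (qpToBdR (c : ℚ_[p])) * (Pη a * bω - Pω a * bη) := by
  rw [hPωZ, hPηZ]; ring

omit [CharZero F] in
include hPωZ hPηZ in
/-- **The resolution on a `ℤ_p`-combination**: `p^N x̃(Σᵢ cᵢ • vᵢ) = Σᵢ cᵢ · (p^N x̃(vᵢ))`, read in `B_dR⁺` through `of⁻¹`.
[cite: Kato1993LNM1553, Ch. II §1.2.4] -/
theorem of_symm_resolution_sum {ι : Type*} (s : Finset ι) (c : ι → ℤ_[p]) (v : ι → W.tateModule p) (bω bη : BdRPlusTop F p) (N : ℕ) :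
    (of F p).symm ((p : BdRPlusTop F p) ^ N * (Pη (∑ i ∈ s, c i • v i) * bω - Pω (∑ i ∈ s, c i • v i) * bη)) =
      ∑ i ∈ s, qpToBdR (c i : ℚ_[p]) * (of F p).symm ((p : BdRPlusTop F p) ^ N * (Pη (v i) * bω - Pω (v i) * bη)) := by
  classical
  induction s using Finset.induction_on with
  | empty => simp
  | insert i s hi ih =>
    rw [Finset.sum_insert hi, Finset.sum_insert hi, map_add, map_add, add_mul, add_mul, ← ih, hPωZ, hPηZ]
    simp only [map_sub, map_mul, map_pow, map_natCast, map_add, RingEquiv.symm_apply_apply]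
    ring

include hPωZ hPηZ in
/-- ★ **(K₂) on a spanning family ⟹ `p^N x̃(η σ) ∈ X⁰₂`** (`X⁰₂` is a `ℤ_p`-module). [cite: FontaineOuyang2022, §6.1]
[cite: Kato1993LNM1553, Ch. II proof of Lemma 1.4.3] -/
theorem isTeichLog_resolution_of_coordinates {ι : Type*} [Fintype ι] (v : ι → W.tateModule p)
    (c : ι → absoluteGaloisGroup F → ℤ_[p]) (η : absoluteGaloisGroup F → W.tateModule p) (hc : ∀ σ, η σ = ∑ i, c i σ • v i)
    (bω bη : BdRPlusTop F p) {N k : ℕ}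
    (hKv : ∀ i, IsTeichLog k ((of F p).symm ((p : BdRPlusTop F p) ^ N * (Pη (v i) * bω - Pω (v i) * bη)))) (σ : absoluteGaloisGroup F) :
    IsTeichLog k ((of F p).symm ((p : BdRPlusTop F p) ^ N * (Pη (η σ) * bω - Pω (η σ) * bη))) := by
  classical
  rw [hc σ, of_symm_resolution_sum W hPωZ hPηZ]
  induction (Finset.univ : Finset ι) using Finset.induction_on with
  | empty => rw [Finset.sum_empty]; exact IsTeichLog.zero k
  | insert i s hi ih => rw [Finset.sum_insert hi]; exact ((hKv i).padicInt_smul (c i σ)).add ih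

include hPωZ hPηZ in
/-- ★★ **(K₂) on a spanning family ⟹ `p`-adic smallness of `p^N x̃(η σ)` near `σ = 1`**: with continuous coordinates vanishing at `1`,
for every `M` one has `p^N x̃(η σ) = p^M · L'_σ` with `L'_σ ∈ X⁰₂` for all `σ` in a neighbourhood of `1` (each coordinate is
`p^M`-divisible near `1`). [cite: Kato1993LNM1553, Ch. II §1.2.5 and proof of Lemma 1.4.3] [cite: FontaineOuyang2022, §6.1] -/
theorem eventually_resolution_small_of_coordinates {ι : Type*} [Fintype ι] (v : ι → W.tateModule p)
    (c : ι → absoluteGaloisGroup F → ℤ_[p]) (hcont : ∀ i, Continuous (c i)) (hc1 : ∀ i, c i 1 = 0)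
    (η : absoluteGaloisGroup F → W.tateModule p) (hc : ∀ σ, η σ = ∑ i, c i σ • v i)
    (bω bη : BdRPlusTop F p) {N k : ℕ}
    (hKv : ∀ i, IsTeichLog k ((of F p).symm ((p : BdRPlusTop F p) ^ N * (Pη (v i) * bω - Pω (v i) * bη)))) (M : ℕ) :
    ∀ᶠ σ in 𝓝 (1 : absoluteGaloisGroup F), ∃ L' : BDeRhamPlus (integerC F) p, IsTeichLog k L' ∧
      (of F p).symm ((p : BdRPlusTop F p) ^ N * (Pη (η σ) * bω - Pω (η σ) * bη)) -
          (p : BDeRhamPlus (integerC F) p) ^ M * L' ∈ Ideal.span {(xiBdR : BDeRhamPlus (integerC F) p) ^ k} := by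
  classical
  -- each coordinate term is `p^M`-divisible near `1`
  have hev : ∀ i, ∀ᶠ σ in 𝓝 (1 : absoluteGaloisGroup F), ∃ Y' : BDeRhamPlus (integerC F) p, IsTeichLog k Y' ∧
      qpToBdR (c i σ : ℚ_[p]) * (of F p).symm ((p : BdRPlusTop F p) ^ N * (Pη (v i) * bω - Pω (v i) * bη)) =
        (p : BDeRhamPlus (integerC F) p) ^ M * Y' := fun i =>
    (hKv i).eventually_exists_eq_pow_mul (hcont i) (hc1 i) M
  have hall : ∀ᶠ σ in 𝓝 (1 : absoluteGaloisGroup F), ∀ i, ∃ Y' : BDeRhamPlus (integerC F) p, IsTeichLog k Y' ∧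
      qpToBdR (c i σ : ℚ_[p]) * (of F p).symm ((p : BdRPlusTop F p) ^ N * (Pη (v i) * bω - Pω (v i) * bη)) =
        (p : BDeRhamPlus (integerC F) p) ^ M * Y' :=
    Filter.eventually_all.2 hev
  filter_upwards [hall] with σ hσ
  choose Y hY hYeq using hσ
  refine ⟨∑ i, Y i, ?_, ?_⟩
  · induction (Finset.univ : Finset ι) using Finset.induction_on with
    | empty => rw [Finset.sum_empty]; exact IsTeichLog.zero k
    | insert i s hi ih => rw [Finset.sum_insert hi]; exact (hY i).add ih
  · rw [hc σ, of_symm_resolution_sum W hPωZ hPηZ, Finset.mul_sum, ← Finset.sum_sub_distrib]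
    refine Ideal.sum_mem _ fun i _ => ?_
    rw [hYeq i, sub_self]
    exact Ideal.zero_mem _

end BdRPlusTop

end Literature.NumberTheory.PAdicHodge

end
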